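import Literature.AnabelianGeometry.SemiGraphs.SplitTransport
import Mathlib.CategoryTheory.Core

/-!
# The universal property of `𝒢_{∞,S}` ([SemiAnbd] §3 p. 38)

For coverings `S`, `T` of `𝒢` with `S` splitting `T` (Def. 3.5 (ii)), base points `x₀ ∈ S_{v₀}`,
`t₀ ∈ T_{v₀}`: there is a morphism of coverings `𝒢_{∞,S} ⟶ T` (`𝒢_{∞,S} = univCoverOver S (inl [x₀])`)
sending the base point `([x₀], x₀, 𝟙)` to `t₀` (`liftHom`, `liftHom_basePt`); it is unique by
rigidity.  This is the heart of [SemiAnbd] Prop. 3.6: "the `𝒢_{∞,i} → 𝒢` are tempered coverings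
… [and every tempered covering split by `𝒢_i` is a quotient of copies of `𝒢_{∞,i}`]".
Construction: the local systems `M(V)`, `M(E)` of equivariant maps (`SplitTransport.lean`) with the
transport bijections along branches form a prefunctor `Cat(𝔾_S) ⥤ Core(Type)`, hence (universal
property of the free groupoid) a functor on the fundamental groupoid of `𝔾_S`; a point `(V, x, p)`
is sent to `(p_* m₀)(x)` where `m₀ ∈ M([x₀])` is `g · x₀ ↦ g · t₀`.
-/

namespace Literature.AnabelianGeometry.SemiGraphs

namespace ProfiniteSemiGraph

open CategoryTheory

universe u

variable {𝒢 : ProfiniteSemiGraph.{u}} (S T : CovObj 𝒢) (hsplit : S.Splits T)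

/-- The local system of equivariant maps on the components of `𝔾_S`.
[cite: MochizukiSemiAnbd2006, Prop 3.6 p.38] -/
def CovObj.OrbitHom : S.orbitGraph.CatCarrier → Type u
  | Sum.inl V => CovObj.OrbitHomV S T V
  | Sum.inr E => CovObj.OrbitHomE S T E

/-- The transport prefunctor `Cat(𝔾_S) ⥤ Core(Type)`: a branch `b : E → V` acts by the transport
bijection `M(E) ≃ M(V)`. [cite: MochizukiSemiAnbd2006, Prop 3.6 p.38] -/
noncomputable def CovObj.transportPrefunctor : S.orbitGraph.CatCarrier ⥤q Core (Type u) where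
  obj c := ⟨CovObj.OrbitHom S T c⟩
  map {c c'} a := match c, c', a with
    | Sum.inr _, Sum.inl V, ⟨⟨(b, E'), hE'⟩, rfl, hv⟩ =>
        CoreHom.mk (Equiv.toIso (CovObj.orbitHomEquiv hsplit b E' hE' V hv))
    | Sum.inl _, Sum.inl _, a => a.elim
    | Sum.inl _, Sum.inr _, a => a.elim
    | Sum.inr _, Sum.inr _, a => a.elim

/-- The transport functor on the fundamental groupoid of `𝔾_S` (universal property of the free
groupoid). [cite: MochizukiSemiAnbd2006, Prop 3.6 p.38] -/
noncomputable def CovObj.transport : S.orbitGraph.FundamentalGroupoid ⥤ Core (Type u) :=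
  Quiver.FreeGroupoid.lift (CovObj.transportPrefunctor S T hsplit)

/-- The transport functor on objects. [cite: MochizukiSemiAnbd2006, Prop 3.6 p.38] -/
theorem CovObj.transport_obj (c : S.orbitGraph.CatCarrier) :
    (CovObj.transport S T hsplit).obj (S.orbitGraph.basept c) = ⟨CovObj.OrbitHom S T c⟩ := rfl

/-- The transport prefunctor on the arrow of a branch. [cite: MochizukiSemiAnbd2006, Prop 3.6 p.38] -/
theorem CovObj.transportPrefunctor_map (b : 𝒢.graph.Branch) (E : S.OEdge)
    (hE : CovObj.OEdge.base S E = 𝒢.graph.edgeOf b) (V : S.OVertex)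
    (hv : S.orbitGraph.abuts ⟨(b, E), hE⟩ = some V) :
    (CovObj.transportPrefunctor S T hsplit).map (X := Sum.inr E) (Y := Sum.inl V)
        ⟨⟨(b, E), hE⟩, rfl, hv⟩ =
      CoreHom.mk (Equiv.toIso (CovObj.orbitHomEquiv hsplit b E hE V hv)) := rfl

/-- The transport functor on the arrow of a branch (as a morphism of `Core(Type)`): the
transport prefunctor's value (universal property of the free groupoid, `lift_spec`).
[cite: MochizukiSemiAnbd2006, Prop 3.6 p.38] -/
theorem CovObj.transport_map_brArrow_eq (b : 𝒢.graph.Branch) (E : S.OEdge)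
    (hE : CovObj.OEdge.base S E = 𝒢.graph.edgeOf b) (V : S.OVertex)
    (hv : S.orbitGraph.abuts ⟨(b, E), hE⟩ = some V) :
    (CovObj.transport S T hsplit).map (S.orbitGraph.brArrow ⟨(b, E), hE⟩ E V rfl hv) =
      (CovObj.transportPrefunctor S T hsplit).map (X := Sum.inr E) (Y := Sum.inl V)
        ⟨⟨(b, E), hE⟩, rfl, hv⟩ := by
  have hc := Prefunctor.congr_hom
    (Quiver.FreeGroupoid.lift_spec (CovObj.transportPrefunctor S T hsplit))
    (X := Sum.inr E) (Y := Sum.inl V) ⟨⟨(b, E), hE⟩, rfl, hv⟩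
  have e1 : S.orbitGraph.brArrow ⟨(b, E), hE⟩ E V rfl hv =
      (Quiver.FreeGroupoid.of S.orbitGraph.CatCarrier).map (X := Sum.inr E) (Y := Sum.inl V)
        ⟨⟨(b, E), hE⟩, rfl, hv⟩ := rfl
  rw [e1]
  exact (Quiver.homOfEq_rfl _).symm.trans hc

/-- The transport functor on the arrow of a branch: the transport bijection.
[cite: MochizukiSemiAnbd2006, Prop 3.6 p.38] -/
theorem CovObj.transport_map_brArrow (b : 𝒢.graph.Branch) (E : S.OEdge)
    (hE : CovObj.OEdge.base S E = 𝒢.graph.edgeOf b) (V : S.OVertex)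
    (hv : S.orbitGraph.abuts ⟨(b, E), hE⟩ = some V) (m : CovObj.OrbitHomE S T E) :
    ((CovObj.transport S T hsplit).map (S.orbitGraph.brArrow ⟨(b, E), hE⟩ E V rfl hv)).iso.hom m =
      CovObj.orbitHomEquiv hsplit b E hE V hv m := by
  rw [CovObj.transport_map_brArrow_eq, CovObj.transportPrefunctor_map]
  rfl

section BasePoint

variable {v₀ : 𝒢.graph.Vertex} (x₀ : (S.SV v₀).obj.V) (t₀ : (T.SV v₀).obj.V)

include hsplit in
/-- Well-definedness of the base section: `g · t₀` only depends on `g · x₀` (splitting).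
[cite: MochizukiSemiAnbd2006, Prop 3.6 p.38] -/
theorem CovObj.baseSection_welldef (g g' : 𝒢.Gv v₀)
    (h : (S.SV v₀).obj.ρ g x₀ = (S.SV v₀).obj.ρ g' x₀) :
    (T.SV v₀).obj.ρ g t₀ = (T.SV v₀).obj.ρ g' t₀ := by
  have hstab : (S.SV v₀).obj.ρ (g⁻¹ * g') x₀ = x₀ := by
    rw [map_mul]
    change (S.SV v₀).obj.ρ g⁻¹ ((S.SV v₀).obj.ρ g' x₀) = x₀
    rw [← h]
    exact Action.ρ_inv_self_apply g x₀
  have h1 := hsplit.1 v₀ x₀ (g⁻¹ * g') hstab t₀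
  rw [map_mul] at h1
  change (T.SV v₀).obj.ρ g⁻¹ ((T.SV v₀).obj.ρ g' t₀) = t₀ at h1
  have h2 := congrArg (fun s => (T.SV v₀).obj.ρ g s) h1
  simp only [Action.ρ_self_inv_apply] at h2
  exact h2.symm

/-- The base section `m₀ ∈ M([x₀])`: `g · x₀ ↦ g · t₀`. [cite: MochizukiSemiAnbd2006, Prop 3.6 p.38] -/
noncomputable def CovObj.baseSection : CovObj.OrbitHomV S T (Quot.mk S.VRel ⟨v₀, x₀⟩) :=
  ⟨fun x => (T.SV v₀).obj.ρ (CovObj.exists_ρ_of_mk_eq_mk S x.2.symm).choose t₀,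
    fun (g : 𝒢.Gv v₀) (x : CovObj.OVertex.Pts S (Quot.mk S.VRel ⟨v₀, x₀⟩)) => by
      have hx := (CovObj.exists_ρ_of_mk_eq_mk S x.2.symm).choose_spec
      have hgx := (CovObj.exists_ρ_of_mk_eq_mk S
        (CovObj.OVertex.act S (Quot.mk S.VRel ⟨v₀, x₀⟩) g x).2.symm).choose_spec
      -- both `choose(g·x)` and `g * choose(x)` send `x₀` to `g · x`
      have key := CovObj.baseSection_welldef S T hsplit x₀ t₀
        (CovObj.exists_ρ_of_mk_eq_mk S (CovObj.OVertex.act S (Quot.mk S.VRel ⟨v₀, x₀⟩) g x).2.symm).choose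
        (g * (CovObj.exists_ρ_of_mk_eq_mk S x.2.symm).choose)
        (by
          rw [hgx, map_mul]
          change _ = (S.SV v₀).obj.ρ g ((S.SV v₀).obj.ρ _ x₀)
          rw [hx]
          rfl)
      beta_reduce
      rw [key, map_mul]
      rfl⟩

/-- The value of the base section on `g · x₀`. [cite: MochizukiSemiAnbd2006, Prop 3.6 p.38] -/
theorem CovObj.baseSection_apply (g : 𝒢.Gv v₀) :
    (CovObj.baseSection S T hsplit x₀ t₀).1
      ⟨(S.SV v₀).obj.ρ g x₀, (Quot.sound (CovObj.VRel.mk (S := S) v₀ g x₀)).symm⟩ =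
      (T.SV v₀).obj.ρ g t₀ := by
  have hx := (CovObj.exists_ρ_of_mk_eq_mk S
    (⟨(S.SV v₀).obj.ρ g x₀, (Quot.sound (CovObj.VRel.mk (S := S) v₀ g x₀)).symm⟩ :
      CovObj.OVertex.Pts S (Quot.mk S.VRel ⟨v₀, x₀⟩)).2.symm).choose_spec
  exact CovObj.baseSection_welldef S T hsplit x₀ t₀ _ _ hx

/-- In particular the base section sends `x₀` to `t₀`. [cite: MochizukiSemiAnbd2006, Prop 3.6 p.38] -/
theorem CovObj.baseSection_apply_base :
    (CovObj.baseSection S T hsplit x₀ t₀).1 ⟨x₀, rfl⟩ = t₀ := by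
  have hx := (CovObj.exists_ρ_of_mk_eq_mk S
    (⟨x₀, rfl⟩ : CovObj.OVertex.Pts S (Quot.mk S.VRel ⟨v₀, x₀⟩)).2.symm).choose_spec
  have h1 : (T.SV v₀).obj.ρ (CovObj.exists_ρ_of_mk_eq_mk S
      (⟨x₀, rfl⟩ : CovObj.OVertex.Pts S (Quot.mk S.VRel ⟨v₀, x₀⟩)).2.symm).choose t₀ =
      (T.SV v₀).obj.ρ 1 t₀ :=
    CovObj.baseSection_welldef S T hsplit x₀ t₀ _ 1 (hx.trans (by rw [map_one]; rfl))
  refine h1.trans ?_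
  rw [map_one]
  rfl

end BasePoint

/-- Evaluation of an element of `M(V)` at a point of the fibre over `v` lying in `V`
(cast-free in the vertex). [cite: MochizukiSemiAnbd2006, Prop 3.6 p.38] -/
def CovObj.evalV (V : S.OVertex) (m : CovObj.OrbitHomV S T V) :
    (v : 𝒢.graph.Vertex) → CovObj.OVertex.base S V = v → (x : (S.SV v).obj.V) →
      Quot.mk S.VRel ⟨v, x⟩ = V → (T.SV v).obj.V
  | _, rfl, x, hx => m.1 ⟨x, hx⟩

/-- Evaluation of an element of `M(E)` at a point of the fibre over `e` lying in `E`.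
[cite: MochizukiSemiAnbd2006, Prop 3.6 p.38] -/
def CovObj.evalE (E : S.OEdge) (m : CovObj.OrbitHomE S T E) :
    (e : 𝒢.graph.Edge) → CovObj.OEdge.base S E = e → (y : (S.SE e).obj.V) →
      Quot.mk S.ERel ⟨e, y⟩ = E → (T.SE e).obj.V
  | _, rfl, y, hy => m.1 ⟨y, hy⟩

section Lift

variable {v₀ : 𝒢.graph.Vertex} (x₀ : (S.SV v₀).obj.V) (t₀ : (T.SV v₀).obj.V) (h𝒢 : 𝒢.IsCountable)

/-- The section of the local system at `(a, p)`: the transport of the base section `m₀` along the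
path class `p`. [cite: MochizukiSemiAnbd2006, Prop 3.6 p.38] -/
noncomputable def CovObj.sect (a : S.orbitGraph.FundamentalGroupoid)
    (p : S.orbitGraph.basept (Sum.inl (Quot.mk S.VRel ⟨v₀, x₀⟩)) ⟶ a) :
    ((CovObj.transport S T hsplit).obj a).of :=
  ((CovObj.transport S T hsplit).map p).iso.hom (CovObj.baseSection S T hsplit x₀ t₀)

/-- Transport along a composite. [cite: MochizukiSemiAnbd2006, Prop 3.6 p.38] -/
theorem CovObj.sect_comp {a a' : S.orbitGraph.FundamentalGroupoid}
    (p : S.orbitGraph.basept (Sum.inl (Quot.mk S.VRel ⟨v₀, x₀⟩)) ⟶ a) (r : a ⟶ a') :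
    CovObj.sect S T hsplit x₀ t₀ a' (p ≫ r) =
      ((CovObj.transport S T hsplit).map r).iso.hom (CovObj.sect S T hsplit x₀ t₀ a p) := by
  unfold CovObj.sect
  rw [Functor.map_comp]
  rfl

/-- The underlying map of the lift on the vertex fibre over `v`: `(V, x, p) ↦ (p_* m₀)(x)`.
[cite: MochizukiSemiAnbd2006, Prop 3.6 p.38] -/
noncomputable def CovObj.liftFunV (v : 𝒢.graph.Vertex)
    (t : S.FibV (Sum.inl (Quot.mk S.VRel ⟨v₀, x₀⟩)) v) : (T.SV v).obj.V :=
  CovObj.evalV S T t.1.1 (CovObj.sect S T hsplit x₀ t₀ (S.orbitGraph.basept (Sum.inl t.1.1)) t.2.2)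
    v t.1.2 t.2.1.1 t.2.1.2

/-- The underlying map of the lift on the edge fibre over `e`. [cite: MochizukiSemiAnbd2006, Prop 3.6 p.38] -/
noncomputable def CovObj.liftFunE (e : 𝒢.graph.Edge)
    (t : S.FibE (Sum.inl (Quot.mk S.VRel ⟨v₀, x₀⟩)) e) : (T.SE e).obj.V :=
  CovObj.evalE S T t.1.1 (CovObj.sect S T hsplit x₀ t₀ (S.orbitGraph.basept (Sum.inr t.1.1)) t.2.2)
    e t.1.2 t.2.1.1 t.2.1.2

/-- Equivariance of the vertex component. [cite: MochizukiSemiAnbd2006, Prop 3.6 p.38] -/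
theorem CovObj.liftFunV_act (v : 𝒢.graph.Vertex) (g : 𝒢.Gv v)
    (t : S.FibV (Sum.inl (Quot.mk S.VRel ⟨v₀, x₀⟩)) v) :
    CovObj.liftFunV S T hsplit x₀ t₀ v (S.fibVAct _ v g t) =
      (T.SV v).obj.ρ g (CovObj.liftFunV S T hsplit x₀ t₀ v t) := by
  cases t with | mk V' xp =>
  cases xp with | mk xx p =>
  cases xx with | mk x hx =>
  cases V' with | mk V hV =>
  change CovObj.OVertex.base S V = v at hV
  subst hV
  exact (CovObj.sect S T hsplit x₀ t₀ (S.orbitGraph.basept (Sum.inl V)) p).2 g ⟨x, hx⟩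

/-- Equivariance of the edge component. [cite: MochizukiSemiAnbd2006, Prop 3.6 p.38] -/
theorem CovObj.liftFunE_act (e : 𝒢.graph.Edge) (g : 𝒢.Ge e)
    (t : S.FibE (Sum.inl (Quot.mk S.VRel ⟨v₀, x₀⟩)) e) :
    CovObj.liftFunE S T hsplit x₀ t₀ e (S.fibEAct _ e g t) =
      (T.SE e).obj.ρ g (CovObj.liftFunE S T hsplit x₀ t₀ e t) := by
  cases t with | mk E' yq =>
  cases yq with | mk yy q =>
  cases yy with | mk y hy =>
  cases E' with | mk E hE =>
  change CovObj.OEdge.base S E = e at hE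
  subst hE
  exact (CovObj.sect S T hsplit x₀ t₀ (S.orbitGraph.basept (Sum.inr E)) q).2 g ⟨y, hy⟩

/-- Compatibility of the lift with the gluings. [cite: MochizukiSemiAnbd2006, Prop 3.6 p.38] -/
theorem CovObj.liftFun_glue (b : 𝒢.graph.Branch) (v : 𝒢.graph.Vertex)
    (h : 𝒢.graph.abuts b = some v) (t : S.FibE (Sum.inl (Quot.mk S.VRel ⟨v₀, x₀⟩)) (𝒢.graph.edgeOf b)) :
    (T.glue b v h).hom.hom.hom (CovObj.liftFunE S T hsplit x₀ t₀ _ t) =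
      CovObj.liftFunV S T hsplit x₀ t₀ v (S.glueOverFun _ b v h t) := by
  cases t with | mk E' yq =>
  cases yq with | mk yy q =>
  cases yy with | mk y hy =>
  cases E' with | mk E hE =>
  -- representatives
  revert q
  revert hy
  revert hE
  induction E using Quot.ind with
  | mk pr =>
  obtain ⟨e', y'⟩ := pr
  intro hE
  cases hE
  intro hy q
  -- the vertex-orbit reached and the branch arrow
  have habuts := S.orbitGraph_abuts_mk b v h ⟨Quot.mk _ ⟨_, y'⟩, rfl⟩ y hy
  -- transport along `q ≫ b̃` = extension of the transport along `q`
  have key := CovObj.transport_map_brArrow S T hsplit b (Quot.mk _ ⟨_, y'⟩) rfl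
    (Quot.mk _ ⟨v, (S.glue b v h).hom.hom.hom y⟩) habuts (CovObj.sect S T hsplit x₀ t₀ _ q)
  have hsc := CovObj.sect_comp S T hsplit x₀ t₀ q (S.brArrowOver b v h ⟨Quot.mk _ ⟨_, y'⟩, rfl⟩ y hy)
  -- the glued point `glue y = 1 · gluePt y`
  have hpt : (⟨(S.glue b v h).hom.hom.hom y, rfl⟩ :
      CovObj.OVertex.Pts S (Quot.mk _ ⟨v, (S.glue b v h).hom.hom.hom y⟩)) =
      CovObj.OVertex.act S _ 1 (CovObj.gluePt b (Quot.mk _ ⟨_, y'⟩) rfl _ habuts ⟨y, hy⟩) := by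
    apply Subtype.ext
    change (S.glue b v h).hom.hom.hom y = (S.SV v).obj.ρ 1 ((S.glue b v h).hom.hom.hom y)
    rw [map_one]
    rfl
  have happ := CovObj.orbitHomExt_apply hsplit b (Quot.mk _ ⟨_, y'⟩) rfl _ habuts
    (CovObj.sect S T hsplit x₀ t₀ _ q) ⟨y, hy⟩ 1
  rw [map_one, ← hpt] at happ
  have e1 : (CovObj.sect S T hsplit x₀ t₀ _
        (q ≫ S.brArrowOver b v h ⟨Quot.mk _ ⟨_, y'⟩, rfl⟩ y hy)).1
        ⟨(S.glue b v h).hom.hom.hom y, rfl⟩ =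
      (CovObj.orbitHomExt hsplit b (Quot.mk _ ⟨_, y'⟩) rfl _ habuts
        (CovObj.sect S T hsplit x₀ t₀ _ q)).1 ⟨(S.glue b v h).hom.hom.hom y, rfl⟩ :=
    congrArg (fun m : CovObj.OrbitHomV S T (Quot.mk _ ⟨v, (S.glue b v h).hom.hom.hom y⟩) =>
      m.1 ⟨(S.glue b v h).hom.hom.hom y, rfl⟩) (hsc.trans key)
  change (T.glue b v h).hom.hom.hom ((CovObj.sect S T hsplit x₀ t₀ _ q).1 ⟨y, hy⟩) =
    (CovObj.sect S T hsplit x₀ t₀ _ (q ≫ S.brArrowOver b v h ⟨Quot.mk _ ⟨_, y'⟩, rfl⟩ y hy)).1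
      ⟨(S.glue b v h).hom.hom.hom y, rfl⟩
  exact (e1.trans happ).symm

/-- **The universal morphism `𝒢_{∞,S} ⟶ T`** determined by a covering `T` split by `S` and base
points `x₀ ∈ S_{v₀}`, `t₀ ∈ T_{v₀}` ([SemiAnbd] p. 38: tempered coverings split by `𝒢_i` are
dominated by `𝒢_{∞,i}`). [cite: MochizukiSemiAnbd2006, Prop 3.6 p.38] -/
noncomputable def CovObj.liftHom :
    S.univCoverOver (Sum.inl (Quot.mk S.VRel ⟨v₀, x₀⟩)) h𝒢 ⟶ T where
  fV v := ObjectProperty.homMk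
    { hom := TypeCat.ofHom (CovObj.liftFunV S T hsplit x₀ t₀ v)
      comm := fun g => by
        apply ConcreteCategory.hom_ext
        intro t
        exact CovObj.liftFunV_act S T hsplit x₀ t₀ v g t }
  fE e := ObjectProperty.homMk
    { hom := TypeCat.ofHom (CovObj.liftFunE S T hsplit x₀ t₀ e)
      comm := fun g => by
        apply ConcreteCategory.hom_ext
        intro t
        exact CovObj.liftFunE_act S T hsplit x₀ t₀ e g t }
  comm b v h := by
    apply ObjectProperty.hom_ext
    apply Action.Hom.ext
    apply ConcreteCategory.hom_ext
    intro t
    exact CovObj.liftFun_glue S T hsplit x₀ t₀ b v h t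

/-- **The universal morphism sends the base point `([x₀], x₀, 𝟙)` to `t₀`.**
[cite: MochizukiSemiAnbd2006, Prop 3.6 p.38] -/
theorem CovObj.liftHom_basePt :
    ((CovObj.liftHom S T hsplit x₀ t₀ h𝒢).fV v₀).hom.hom
      (⟨⟨Quot.mk S.VRel ⟨v₀, x₀⟩, rfl⟩, ⟨⟨x₀, rfl⟩, 𝟙 _⟩⟩ : S.FibV _ v₀) = t₀ := by
  change (((CovObj.transport S T hsplit).map
    (𝟙 (S.orbitGraph.basept (Sum.inl (Quot.mk S.VRel ⟨v₀, x₀⟩))))).iso.hom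
    (CovObj.baseSection S T hsplit x₀ t₀)).1 ⟨x₀, rfl⟩ = t₀
  have hid : (CovObj.transport S T hsplit).map
      (𝟙 (S.orbitGraph.basept (Sum.inl (Quot.mk S.VRel ⟨v₀, x₀⟩)))) = 𝟙 _ :=
    CategoryTheory.Functor.map_id _ _
  have e := congrArg (fun f : (CovObj.transport S T hsplit).obj
      (S.orbitGraph.basept (Sum.inl (Quot.mk S.VRel ⟨v₀, x₀⟩))) ⟶
      (CovObj.transport S T hsplit).obj (S.orbitGraph.basept (Sum.inl (Quot.mk S.VRel ⟨v₀, x₀⟩))) =>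
    (f.iso.hom (CovObj.baseSection S T hsplit x₀ t₀) :
      CovObj.OrbitHomV S T (Quot.mk S.VRel ⟨v₀, x₀⟩)).1 ⟨x₀, rfl⟩) hid
  exact e.trans (CovObj.baseSection_apply_base S T hsplit x₀ t₀)

end Lift

end ProfiniteSemiGraph

end Literature.AnabelianGeometry.SemiGraphs
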